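import Literature.MathematicalPhysics.QuantumFieldTheory.Balaban1983to89.B9Eq324DeltaPrimeATower

/-!
# `Balaban1983to89.B9Eq324DeltaPrimeATowerKernel` — T. Bałaban, *Propagators for lattice gauge theories in a background field*, Commun. Math.
# Phys. **99** (1985) 389–434 [Balaban1985BackgroundPropagators] (3.24)–(3.25) p. 394, p. 395 «it can be easily shown that the operator Δ′_a is
# positive», Thm 3.11 p. 416: **THE KERNEL CLAUSE OF PRINT's `k`-TH-STEP SITE OPERATOR `Δ′_{a′,k}(U) = Δ^η_U + a′Q̃′_k(U)†Q̃′_k(U)`** —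
# `Δ′_{a′,k}(U)` is positive definite IFF `ker D_U ∩ ker Q′_k(U) = 0` (mutually adjoint transporters, `a′ > 0`); the clause HOLDS at the flat
# background at every number of levels (through the owner's period identity and NE9 leaf-01's one-step clause at block `L^{n+1}`); and the Green's
# function of a conjugated operator is the conjugated Green's function — the kernel-side sibling of the owner's `B9Eq324DeltaPrimeATower` (whose
# positivity road is the small-field coercivity), item (b2) of the owner g85's NEXT PROGRAMME («the k-level kernel clause sibling — leaf-04 holds it»)

statement-level skeleton of published theorems with citation tags; proofs where landed; nothing here is a claim about the Yang–Mills mass gap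

CITATION HEADER (lean-in-tree rule).  Audit cell `pub-balaban`, sub-cell `t4`, BINDER row NE9; filed by NE9 formalisation-swarm LEAF PROVER 04
(`b2b-balaban-t4-ne9-formalise-leaf-04`, gen 76): the kernel-clause lemmas of the lineage's gen-75 independent port of (3.24)–(3.25) one storey up
(`g75/stage/B9Eq325ProjFormulaTower.v1.staged.lean` 7e96b0708e1bc0cb, WITHDRAWN for the owner's same-storey files l.47493 — «welcome after INTENT-1 ✓»,
owner W-4 (3) l.47728; owner g85 FINAL (b2)), re-based on the owner's definitions `laplacePrimeAk` ∕ `GpOfUk`.  Source READ in the held text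
`paper:balaban1985-cmp99-background-propagators`: pp. 393–395, 416.

THE PRINT (verbatim).  p. 395: *«it can be easily shown that the operator Δ′_a is positive, so the minimum exists and is unique»*; p. 416, Thm 3.11:
*«… the operators Δ′_a, G′, (Q′G′²Q′*)⁻¹, Δ_a, G are positive definite.»*  The null-space half of «positive»: `⟨λ, Δ′_aλ⟩ = ‖D_Uλ‖² + a′‖Q̃′λ‖²`
vanishes iff `D_Uλ = 0` and `Q′λ = 0`, and a covariantly constant `λ` with vanishing block averages is `0`.

WHAT IS PROVED (sorry-free; proof lane — no `def`, no `Prop` placeholder; nothing of [B9] asserted beyond the algebra).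
* §1 at a GENERAL background with mutually adjoint transporters (`hRS`) and `a′ > 0`: `QprimeTowerL2_eq_zero_iff` (the weight-`c₁` reading of `Q′_k`
  has the kernel of `Q′_k`), **`laplacePrimeAk_pos_of_kernel`** (the DISPLAYED clause `D_Uλ = 0 → Q′_k(U)λ = 0 → λ = 0` inhabits the positivity
  binder `hpos′` of the owner's `GpOfUk` — no smallness), **`kernel_of_laplacePrimeAk_pos`** (conversely positivity gives the clause) and
  **`laplacePrimeAk_pos_iff_kernel`** (print's «positive definite» ⇔ `ker D_U ∩ ker Q′_k(U) = 0`).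
* §2 at the FLAT background: `adTransportW_one_tower` ∕ `hRS_one_tower` (flat transports are the identity, hence mutually adjoint),
  **`eq_zero_of_covDerivL2K_of_QprimeTowerW_one`** — THE CLAUSE HOLDS at `U ≡ 1` for every `n` (`η ≠ 0`): the owner's
  `B9Eq316TowerFlatIsOneStep.QprimeTowerW_one_eq_zero_iff` + `covDerivL2K_siteL2Cast` carry it to NE9 leaf-01's one-step clause
  `B9Thm311DeltaPrimeA.eq_zero_of_covDerivL2K_of_QprimeW` at block `L^{n+1}`; `laplacePrimeAk_one_pos_of_kernel` — the flat positivity by the kernel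
  road (the owner's `laplacePrimeAk_one_pos` reaches the same statement by conjugating the one-step form; the two roads agree).
* §3 **`greenK_conj`** ([folklore]: `T′ = Ψ⁻¹TΨ` ⇒ `greenK T′ = Ψ⁻¹ ∘ greenK T ∘ Ψ` at ANY positivity witnesses, by injectivity of `T′`) — the
  generic form of the owner's `GpOfUk_one_apply`, reusable for the block-gauge conjugations of the tower files.
HONEST SCOPE.  Exact linear algebra on the owner's objects; the kernel clause at a GENERAL background `U` at `k` levels (the composite-averaging
analogue of leaf-01's `kernel_of_flat_of_avgQ` road) is NOT here — at `U ≠ 1` the chain takes positivity from the small-field coercivity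
(`laplacePrimeAk_pos_of_coercive`); no estimate, no constant; one API letter of a route step, NOT NE9 (cell pub-balaban: NE9 NOT PRINTED ∕ NOT PROVED;
«NE9 ⇐ the named binders»; row WALLED ON A MODEL (O-NE9-1); spine PROVED 0∕9; rung (B)+1 on a finite T⁴ — NOT infinite volume, NOT mass gap, NOT Clay;
HONEST DEPENDENCY: continuum YM on T⁴ ⇐ BetaPertH ∧ nine spine estimates (0/9 proved); BetaPertH ⇐ (D1) ∧ (D4) ∧ CAP+tail; G-an2-4 gates asym, D1
and NE2/3/4).  NEW file importing `B9Eq324DeltaPrimeATower` only; nothing modified.  Net new unproved facts: 0.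
-/

noncomputable section

open scoped InnerProductSpace ComplexConjugate BigOperators

namespace Literature.MathematicalPhysics.QuantumFieldTheory.Balaban1983to89.B9Eq324DeltaPrimeATowerKernel

open B4Sect5Torus (TSite)
open B9SectCLatticeCarrier (Bond)
open B9Eq311L2Pairing (WL2)
open B9Eq319QprimeTorus (fineP)
open B11Eq103H1Complex (SiteL2K BondL2K covDerivL2K greenK apply_greenK injective_of_rePosDef)
open B9Eq310HessianOperator (adTransportW adTransportW_apply)
open B9Eq315QTower (towerP)
open B9Eq326OperatorAssembly (QprimeW)
open B9Eq326OperatorTower (QprimeTowerW)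
open B9Thm311DeltaPrimeA (eq_zero_of_covDerivL2K_of_QprimeW)
open B9Eq316TowerFlatIsOneStep (siteL2Cast bondCast covDerivL2K_siteL2Cast QprimeTowerW_one_eq_zero_iff towerP_eq_fineP_pow)
open B9Eq324DeltaPrimeATower (laplacePrimeAk re_inner_laplacePrimeAk)

/-! ## §1 General background: positive definite ⇔ the kernel clause -/

section General

variable {d : ℕ} (L : ℕ) [NeZero L] (m : Fin d → ℕ) [∀ i, NeZero (m i)] (n : ℕ)
  {𝔸 : Type*} [NormedRing 𝔸] [NormedAlgebra ℂ 𝔸] [CompleteSpace 𝔸]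
  {W : Type*} [NormedAddCommGroup W] [InnerProductSpace ℂ W] [FiniteDimensional ℂ W] (φ : W ≃ₗ[ℂ] 𝔸) {c₀ : ℝ} [Fact (0 < c₀)]
  (η : ℝ) (U : Bond d (towerP L m (n + 1)) → 𝔸ˣ) {c₁ : ℝ} [Fact (0 < c₁)] (a' : ℝ)

omit [FiniteDimensional ℂ W] [Fact (0 < c₀)] [Fact (0 < c₁)] in
/-- The weight-`c₁` reading `Q̃′_k(U)` has the kernel of `Q′_k(U)`. [cite: Balaban1985BackgroundPropagators, (3.19) p.393, (3.24) p.394] -/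
theorem QprimeTowerL2_eq_zero_iff (l : SiteL2K ℂ d (towerP L m (n + 1)) c₀ W) :
    ((WL2.linearEquiv ℂ ℂ (fun _ : TSite d m => c₁)).symm.toLinearMap ∘ₗ QprimeTowerW L m n φ U (c₀ := c₀)) l = 0 ↔
      QprimeTowerW L m n φ U l = 0 := by
  rw [LinearMap.comp_apply, LinearEquiv.coe_toLinearMap, LinearEquiv.map_eq_zero_iff]

variable (hRS : ∀ (b : Bond d (towerP L m (n + 1))) (v u : W), ⟪adTransportW φ U b v, u⟫_ℂ = ⟪v, adTransportW φ (fun b => (U b)⁻¹) b u⟫_ℂ)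
include hRS

/-- **`Δ′_{a′,k}(U)` IS POSITIVE DEFINITE MODULO THE KERNEL CLAUSE** (no smallness): for `a′ > 0`, mutually adjoint transporters and the DISPLAYED
clause `D_Uλ = 0 → Q′_k(U)λ = 0 → λ = 0`, `0 < re⟪λ, Δ′_{a′,k}(U)λ⟫` for `λ ≠ 0` — LITERALLY the binder `hpos′` of the owner's `GpOfUk`.
[cite: Balaban1985BackgroundPropagators, Thm 3.11 p.416, (3.24)–(3.25) p.394, p.395] -/
theorem laplacePrimeAk_pos_of_kernel (ha : 0 < a')
    (hker : ∀ x : SiteL2K ℂ d (towerP L m (n + 1)) c₀ W,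
      covDerivL2K ℂ c₀ ((η : ℂ))⁻¹ (adTransportW φ U) x = 0 → QprimeTowerW L m n φ U x = 0 → x = 0)
    (x : SiteL2K ℂ d (towerP L m (n + 1)) c₀ W) (hx : x ≠ 0) :
    0 < RCLike.re ⟪x, laplacePrimeAk L m n φ η U a' (c₁ := c₁) x⟫_ℂ := by
  rw [re_inner_laplacePrimeAk L m n φ η U a' hRS]
  by_cases hD : covDerivL2K ℂ c₀ ((η : ℂ))⁻¹ (adTransportW φ U) x = 0
  · by_cases hQ : QprimeTowerW L m n φ U x = 0
    · exact absurd (hker x hD hQ) hx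
    · have hQ' : ((WL2.linearEquiv ℂ ℂ (fun _ : TSite d m => c₁)).symm.toLinearMap ∘ₗ QprimeTowerW L m n φ U) x ≠ 0 :=
        fun h0 => hQ ((QprimeTowerL2_eq_zero_iff L m n φ U x).1 h0)
      have : 0 < a' * ‖((WL2.linearEquiv ℂ ℂ (fun _ : TSite d m => c₁)).symm.toLinearMap ∘ₗ QprimeTowerW L m n φ U) x‖ ^ 2 :=
        mul_pos ha (by positivity)
      positivity
  · have : 0 < ‖covDerivL2K ℂ c₀ ((η : ℂ))⁻¹ (adTransportW φ U) x‖ ^ 2 := by positivity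
    have : 0 ≤ a' * ‖((WL2.linearEquiv ℂ ℂ (fun _ : TSite d m => c₁)).symm.toLinearMap ∘ₗ QprimeTowerW L m n φ U) x‖ ^ 2 :=
      mul_nonneg ha.le (by positivity)
    positivity

/-- **CONVERSELY, POSITIVITY GIVES THE KERNEL CLAUSE**: if `0 < re⟪λ, Δ′_{a′,k}(U)λ⟫` for all `λ ≠ 0`, then `D_Uλ = 0 ∧ Q′_k(U)λ = 0 ⇒ λ = 0` (the form
is `‖D_Uλ‖² + a′‖Q̃′_kλ‖²`). [cite: Balaban1985BackgroundPropagators, (3.24) p.394, p.395] -/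
theorem kernel_of_laplacePrimeAk_pos
    (hpos : ∀ x : SiteL2K ℂ d (towerP L m (n + 1)) c₀ W, x ≠ 0 → 0 < RCLike.re ⟪x, laplacePrimeAk L m n φ η U a' (c₁ := c₁) x⟫_ℂ)
    (x : SiteL2K ℂ d (towerP L m (n + 1)) c₀ W) (hD : covDerivL2K ℂ c₀ ((η : ℂ))⁻¹ (adTransportW φ U) x = 0)
    (hQ : QprimeTowerW L m n φ U x = 0) : x = 0 := by
  by_contra hx
  have h := hpos x hx
  rw [re_inner_laplacePrimeAk L m n φ η U a' hRS, hD, norm_zero, LinearMap.comp_apply, hQ, map_zero, norm_zero] at h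
  norm_num at h

/-- **PRINT's «Δ′_a POSITIVE DEFINITE» ⇔ `ker D_U ∩ ker Q′_k(U) = 0`** (mutually adjoint transporters, `a′ > 0`).
[cite: Balaban1985BackgroundPropagators, Thm 3.11 p.416, (3.24)–(3.25) p.394, p.395] -/
theorem laplacePrimeAk_pos_iff_kernel (ha : 0 < a') :
    (∀ x : SiteL2K ℂ d (towerP L m (n + 1)) c₀ W, x ≠ 0 → 0 < RCLike.re ⟪x, laplacePrimeAk L m n φ η U a' (c₁ := c₁) x⟫_ℂ) ↔
      ∀ x : SiteL2K ℂ d (towerP L m (n + 1)) c₀ W,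
        covDerivL2K ℂ c₀ ((η : ℂ))⁻¹ (adTransportW φ U) x = 0 → QprimeTowerW L m n φ U x = 0 → x = 0 :=
  ⟨fun hpos => kernel_of_laplacePrimeAk_pos L m n φ η U a' hRS hpos,
    fun hker => laplacePrimeAk_pos_of_kernel L m n φ η U a' hRS ha hker⟩

end General

/-! ## §2 The flat background: the clause holds at every number of levels -/

section Flat

variable {d : ℕ} (L : ℕ) [NeZero L] (m : Fin d → ℕ) [∀ i, NeZero (m i)] (n : ℕ)
  {𝔸 : Type*} [NormedRing 𝔸] [NormedAlgebra ℂ 𝔸] [CompleteSpace 𝔸]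
  {W : Type*} [NormedAddCommGroup W] [InnerProductSpace ℂ W] [FiniteDimensional ℂ W] (φ : W ≃ₗ[ℂ] 𝔸) {c₀ : ℝ} [Fact (0 < c₀)]
  (η : ℝ) {c₁ : ℝ} [Fact (0 < c₁)] (a' : ℝ)

omit [NeZero L] [∀ i, NeZero (m i)] [CompleteSpace 𝔸] [FiniteDimensional ℂ W] [Fact (0 < c₀)] in
/-- The flat transport of the tower's fine torus is the identity on the fibre. [cite: Balaban1985BackgroundPropagators, (3.2) p.390, p.395] -/
theorem adTransportW_one_tower (b : Bond d (towerP L m (n + 1))) (v : W) :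
    adTransportW φ (fun _ : Bond d (towerP L m (n + 1)) => (1 : 𝔸ˣ)) b v = v := by
  simp [adTransportW_apply]

omit [NeZero L] [∀ i, NeZero (m i)] [CompleteSpace 𝔸] [FiniteDimensional ℂ W] [Fact (0 < c₀)] in
/-- The `hRS` letter at the flat background of the tower's fine torus (both transports are the identity). [cite: Balaban1985BackgroundPropagators, p.395] -/
theorem hRS_one_tower (b : Bond d (towerP L m (n + 1))) (v u : W) :
    ⟪adTransportW φ (fun _ : Bond d (towerP L m (n + 1)) => (1 : 𝔸ˣ)) b v, u⟫_ℂ =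
      ⟪v, adTransportW φ (fun b => ((fun _ : Bond d (towerP L m (n + 1)) => (1 : 𝔸ˣ)) b)⁻¹) b u⟫_ℂ := by
  rw [adTransportW_one_tower]
  have h1 : (fun b => ((fun _ : Bond d (towerP L m (n + 1)) => (1 : 𝔸ˣ)) b)⁻¹) = fun _ : Bond d (towerP L m (n + 1)) => (1 : 𝔸ˣ) := by
    funext b; simp
  rw [h1, adTransportW_one_tower]

omit [FiniteDimensional ℂ W] in
/-- **THE KERNEL CLAUSE AT THE FLAT BACKGROUND, EVERY NUMBER OF LEVELS**: `D_1λ = 0 ∧ Q′_k(1)λ = 0 ⇒ λ = 0` (`η ≠ 0`) — through the owner's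
`QprimeTowerW_one_eq_zero_iff` (`Q′_k(1)λ = 0 ↔ Q′^{(L^{n+1})}(1)(Φ′λ) = 0`), `covDerivL2K_siteL2Cast` (`D_1(Φ′λ) = Φ(D_1λ)`) and NE9 leaf-01's
one-step clause `B9Thm311DeltaPrimeA.eq_zero_of_covDerivL2K_of_QprimeW` at block `L^{n+1}`. [cite: Balaban1985BackgroundPropagators, (3.23)–(3.24) p.394, (3.19) p.393, p.395] -/
theorem eq_zero_of_covDerivL2K_of_QprimeTowerW_one (hη : η ≠ 0) {x : SiteL2K ℂ d (towerP L m (n + 1)) c₀ W}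
    (hD : covDerivL2K ℂ c₀ ((η : ℂ))⁻¹ (adTransportW φ (fun _ : Bond d (towerP L m (n + 1)) => (1 : 𝔸ˣ))) x = 0)
    (hQ : QprimeTowerW L m n φ (fun _ : Bond d (towerP L m (n + 1)) => (1 : 𝔸ˣ)) x = 0) : x = 0 := by
  have h : towerP L m (n + 1) = fineP (L ^ (n + 1)) m := towerP_eq_fineP_pow L m (n + 1)
  haveI : NeZero (L ^ (n + 1)) := ⟨pow_ne_zero _ (NeZero.ne L)⟩
  have hQ' := (QprimeTowerW_one_eq_zero_iff L m n φ h x).1 hQ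
  have hD' : covDerivL2K ℂ c₀ ((η : ℂ))⁻¹ (adTransportW φ (fun _ : Bond d (fineP (L ^ (n + 1)) m) => (1 : 𝔸ˣ))) (siteL2Cast ℂ h x) = 0 := by
    rw [covDerivL2K_siteL2Cast]
    have hc : (adTransportW φ (fun _ : Bond d (fineP (L ^ (n + 1)) m) => (1 : 𝔸ˣ))) ∘ bondCast h =
        adTransportW φ (fun _ : Bond d (towerP L m (n + 1)) => (1 : 𝔸ˣ)) := rfl
    rw [hc, hD, map_zero]
  have hx := eq_zero_of_covDerivL2K_of_QprimeW (L ^ (n + 1)) m φ η _ hη hD' hQ'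
  exact (siteL2Cast ℂ h).map_eq_zero_iff.1 hx

/-- **THE FLAT POSITIVITY BY THE KERNEL ROAD** — `η ≠ 0`, `a′ > 0` only: the same statement as the owner's `laplacePrimeAk_one_pos` (which conjugates
the one-step FORM); here from `laplacePrimeAk_pos_of_kernel` + the flat clause. The two roads agree. [cite: Balaban1985BackgroundPropagators, Thm 3.11 p.416, p.395] -/
theorem laplacePrimeAk_one_pos_of_kernel (hη : η ≠ 0) (ha : 0 < a') (x : SiteL2K ℂ d (towerP L m (n + 1)) c₀ W) (hx : x ≠ 0) :
    0 < RCLike.re ⟪x, laplacePrimeAk L m n φ η (fun _ : Bond d (towerP L m (n + 1)) => (1 : 𝔸ˣ)) a' (c₁ := c₁) x⟫_ℂ :=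
  laplacePrimeAk_pos_of_kernel L m n φ η _ a' (hRS_one_tower L m n φ) ha
    (fun _ hD hQ => eq_zero_of_covDerivL2K_of_QprimeTowerW_one L m n φ η hη hD hQ) x hx

end Flat

/-! ## §3 Green's functions along a conjugation -/

section Conj

/-- **`greenK` OF A CONJUGATED OPERATOR**: if `T′ = Ψ⁻¹ ∘ T ∘ Ψ` for a linear equivalence `Ψ`, then `(T′)⁻¹x = Ψ⁻¹(T⁻¹(Ψx))` (`greenK` of both, at
ANY positivity witnesses) — by injectivity of `T′`. [folklore] [cite: Balaban1985BackgroundPropagators, (3.25) p.394] -/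
theorem greenK_conj {E E' : Type*} [NormedAddCommGroup E] [InnerProductSpace ℂ E] [FiniteDimensional ℂ E]
    [NormedAddCommGroup E'] [InnerProductSpace ℂ E'] [FiniteDimensional ℂ E'] (Ψ : E ≃ₗ[ℂ] E') (T : E' →ₗ[ℂ] E') (T' : E →ₗ[ℂ] E)
    (hT' : T' = Ψ.symm.toLinearMap ∘ₗ T ∘ₗ Ψ.toLinearMap)
    (hpos : ∀ x : E', x ≠ 0 → 0 < RCLike.re ⟪x, T x⟫_ℂ) (hpos' : ∀ x : E, x ≠ 0 → 0 < RCLike.re ⟪x, T' x⟫_ℂ) (x : E) :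
    greenK T' hpos' x = Ψ.symm (greenK T hpos (Ψ x)) := by
  apply injective_of_rePosDef hpos'
  rw [apply_greenK, hT']
  simp only [LinearMap.comp_apply, LinearEquiv.coe_toLinearMap, LinearEquiv.apply_symm_apply, apply_greenK, LinearEquiv.symm_apply_apply]

/-- Operator form: `greenK T′ = Ψ⁻¹ ∘ₗ greenK T ∘ₗ Ψ`. [folklore] [cite: Balaban1985BackgroundPropagators, (3.25) p.394] -/
theorem greenK_conj_eq {E E' : Type*} [NormedAddCommGroup E] [InnerProductSpace ℂ E] [FiniteDimensional ℂ E]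
    [NormedAddCommGroup E'] [InnerProductSpace ℂ E'] [FiniteDimensional ℂ E'] (Ψ : E ≃ₗ[ℂ] E') (T : E' →ₗ[ℂ] E') (T' : E →ₗ[ℂ] E)
    (hT' : T' = Ψ.symm.toLinearMap ∘ₗ T ∘ₗ Ψ.toLinearMap)
    (hpos : ∀ x : E', x ≠ 0 → 0 < RCLike.re ⟪x, T x⟫_ℂ) (hpos' : ∀ x : E, x ≠ 0 → 0 < RCLike.re ⟪x, T' x⟫_ℂ) :
    greenK T' hpos' = Ψ.symm.toLinearMap ∘ₗ greenK T hpos ∘ₗ Ψ.toLinearMap :=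
  LinearMap.ext fun x => greenK_conj Ψ T T' hT' hpos hpos' x

end Conj

end Literature.MathematicalPhysics.QuantumFieldTheory.Balaban1983to89.B9Eq324DeltaPrimeATowerKernel

end
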